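import Mathlib
import HarnessLib

/-!
# Crux U `FreeProbeLawG` (stmt-QuantumFields-23756), line `birth` — assembly part A3e: monomial absorption

Lead `ym-line-sgb-k1-g1`; helper for the exponent bookkeeping of the registered stub `stub_assembly`: a monomial `a P^N β^e` with
`1 ≤ P ≤ Q β^κ₀` and `e + κ₀ N ≤ −l` is at most `a Q^Ntot β^(−l)`. Pure real arithmetic. HONEST LABEL: RECORD rung R2ξ-G only.
-/

set_option autoImplicit false

namespace Summit.QuantumFields.YangMills.Cruxes.FreeProbeLawG.SteinFree

namespace AssemblyFinal

/-- Monomial absorption: `a P^N β^e ≤ a Q^Ntot β^(−l)` when `1 ≤ β`, `1 ≤ P ≤ Q β^κ₀`, `1 ≤ Q`, `0 ≤ N ≤ Ntot`, `e + κ₀ N ≤ −l`. -/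
theorem mono_le {a P Q β κ₀ N Ntot e l : ℝ} (ha : 0 ≤ a) (hβ : 1 ≤ β) (hP1 : 1 ≤ P) (hQ1 : 1 ≤ Q) (hPQ : P ≤ Q * β ^ κ₀)
    (hN : 0 ≤ N) (hNN : N ≤ Ntot) (he : e + κ₀ * N ≤ -l) :
    a * P ^ N * β ^ e ≤ a * Q ^ Ntot * β ^ (-l) := by
  have hβ0 : 0 < β := lt_of_lt_of_le one_pos hβ
  have hP0 : 0 ≤ P := le_trans zero_le_one hP1
  have h1 : P ^ N ≤ Q ^ N * β ^ (κ₀ * N) := by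
    calc P ^ N ≤ (Q * β ^ κ₀) ^ N := Real.rpow_le_rpow hP0 hPQ hN
      _ = Q ^ N * (β ^ κ₀) ^ N := Real.mul_rpow (le_trans zero_le_one hQ1) (Real.rpow_nonneg hβ0.le _)
      _ = Q ^ N * β ^ (κ₀ * N) := by rw [← Real.rpow_mul hβ0.le]
  have h2 : Q ^ N ≤ Q ^ Ntot := Real.rpow_le_rpow_of_exponent_le hQ1 hNN
  have h3 : β ^ (κ₀ * N) * β ^ e ≤ β ^ (-l) := by
    rw [← Real.rpow_add hβ0]
    exact Real.rpow_le_rpow_of_exponent_le hβ (by linarith)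
  have hβe : 0 ≤ β ^ e := Real.rpow_nonneg hβ0.le _
  calc a * P ^ N * β ^ e ≤ a * (Q ^ N * β ^ (κ₀ * N)) * β ^ e :=
        mul_le_mul_of_nonneg_right (mul_le_mul_of_nonneg_left h1 ha) hβe
    _ = a * Q ^ N * (β ^ (κ₀ * N) * β ^ e) := by ring
    _ ≤ a * Q ^ Ntot * β ^ (-l) := by
        refine mul_le_mul (mul_le_mul_of_nonneg_left h2 ha) h3 (by positivity) ?_
        exact mul_nonneg ha (Real.rpow_nonneg (le_trans zero_le_one hQ1) _)

end AssemblyFinal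

end Summit.QuantumFields.YangMills.Cruxes.FreeProbeLawG.SteinFree
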